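import Summits.ValiantsHypothesis.ValiantsHypothesis.Theorems.LacunarySymmetroidMatrixDescartesPivotStaircaseAllK

/-!
# `MatrixDescartes` (stmt-ValiantsHypothesis-18050) — THE `K`-FREE PIVOT-INDEX LAW `PivotIndexLaw` (PIL) IS FALSE

HONEST FRAMING.  Cell `pub-symmetroid`, seat `val-sym-mdr-p2` (gen 24); helper file `--supports` the crux
`Theses.LacunarySymmetroid.MatrixDescartes` (OPEN), NO closure claim.  Conjb-1 g0's law-level shape PIL
(`…CensusPivotDefs.PivotIndexLaw := ∃ C, ∀ m K q, PivotRootLawAt m K q (2m·(q+1)^{C·log₂(m+1)})`, status «OPEN; its `q = 1`,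
`C`-free instance R1 is refuted, so PIL can only hold with the `log` factor doing real work») has a budget that does NOT depend on
`K`; at `m = 2`, `q = 1` it is the constant `4·2^C`, while the `m = 2` index-one row is `≥ 2K` for EVERY `K` (pole weaving,
`…PivotStaircaseAllK`, `not_pivotRootLawAt_two_indexOne`).  Hence **`not_pivotIndexLaw : ¬ PivotIndexLaw`** — for every `C`,
at `K = 2·2^C + 2`.  The `K`-dependent shapes PIL_K (`PivotIndexLawK`, factor `2^{CK}`) and PIL′ (`PivotIndexLawPoly`,
factor `(m(K+1))^C`) are untouched (their budgets grow with `K` faster than `2(m−1)(K−1)+2`), as are R1″/R1‴/R1‴b/R1′ and the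
crux.  Nothing here bears on `MatrixDescartes` in its window, on `DoorA26`/`DoorA34`, on the registers, or on `VP ≠ VNP`.
[folklore] Bookkeeping over the tree.
-/

set_option linter.dupNamespace false

namespace Summit.ValiantsHypothesis.ValiantsHypothesis.Theorems.LacunarySymmetroidMatrixDescartes.Pivot

/-- For every `C`, PIL's `(m, q) = (2, 1)` budget `4·2^C` is beaten at `K = 2·2^C + 2`. -/
theorem not_pivotRootLawAt_pil_budget (C : ℕ) :
    ¬ PivotRootLawAt 2 (2 * 2 ^ C + 2) 1 (2 * 2 * (1 + 1) ^ (C * Nat.log 2 (2 + 1))) := by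
  intro h
  have hlog : Nat.log 2 (2 + 1) = 1 := by decide
  have hK : 2 ≤ 2 * 2 ^ C + 2 := by omega
  refine not_pivotRootLawAt_two_indexOne (2 * 2 ^ C + 2) hK (pivotRootLawAt_mono h ?_)
  rw [hlog, mul_one, show (1 + 1 : ℕ) = 2 from rfl]
  omega

/-- **PIL IS FALSE**: the `K`-free pivot-index law `PivotIndexLaw` fails for every constant `C` (at `m = 2`, `q = 1`,
`K = 2·2^C + 2`, where pole weaving gives `Z₊ ≥ 2K = 4·2^C + 4 > 4·2^C`). -/
theorem not_pivotIndexLaw : ¬ PivotIndexLaw := by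
  rintro ⟨C, h⟩
  exact not_pivotRootLawAt_pil_budget C (h 2 (2 * 2 ^ C + 2) 1)

end Summit.ValiantsHypothesis.ValiantsHypothesis.Theorems.LacunarySymmetroidMatrixDescartes.Pivot
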